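import Mathlib
import HarnessLib

/-!
# `det K = D²` for Kasteleyn-type matrices — helper file: even cycle covers ≃ (perfect matchings)²

Route `ValiantsHypothesis/DivisionGap`, crux item `stmt-ValiantsHypothesis-5066`, line
`charged-uncharged`, stub `stub_kasteleynDetSq`, helper file.

The Pfaffian-free proof of Kasteleyn's identity `det K = (Σ_{perfect matchings} ∏ weights)²`
(Kasteleyn 1961/1967; Lovász–Plummer, *Matching Theory*, Lemma 8.3.1 / Thm 8.3.3) rests on the
bijection between EVEN CYCLE COVERS (fixed-point-free permutations `σ` all of whose cycles have
even length) and ORDERED PAIRS OF PERFECT MATCHINGS (pairs `(f₁, f₂)` of fixed-point-free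
involutions `V → V`), with `{f₁ v, f₂ v} = {σ v, σ⁻¹ v}` for every vertex `v`.  This file builds
both directions, WITHOUT introducing definitions (everything is spelled out):

* the representative `(kds_orbit_nonempty σ v).choose` of the `σ`-orbit
  `univ.filter (σ.SameCycle v ·)` of `v` depends only on the orbit as a SET (`kds_rep_congr`);
* alternating colourings `col : V → Bool`, `∀ v, col (σ v) = !col v`: normalised by
  `col (representative) = true` such a colouring is unique (`kds_col_unique`) and exists when `σ`
  is fixed-point-free with all cycles even (`kds_exists_col`, parity of the position on the
  cycle);
* the pair `(fun v => if col v then σ v else σ⁻¹ v, fun v => if col v then σ⁻¹ v else σ v)` —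
  two fixed-point-free involutions (`kds_pair_mem`);
* `kds_exists_preimage` — every pair `(f₁, f₂)` arises this way from an even cycle cover `σ`
  with a normalised alternating colouring: with `g = f₁ ∘ f₂` the `g`-orbits of `v` and `f₂ v`
  are DISJOINT (`kds_pair_orbits`: if `f₂ v = gⁱ v` then `f₂` or `f₁` has a fixed point according
  to the parity of `i`), their union is the component of `v` in `f₁ ∪ f₂`, and "the chosen point
  of the component lies in the `g`-orbit of `v`" is an alternating colouring for both `f₁` and
  `f₂`; put `σ v = if col v then f₁ v else f₂ v`.

Injectivity and the resulting sum identity are in the stub file.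
-/

open Finset Equiv Equiv.Perm

set_option linter.dupNamespace false

namespace Summit.ValiantsHypothesis.ValiantsHypothesis.Theorems.DivisionGapZeroOneTransfer

variable {V : Type*}

/-! ## Orbit representatives -/

/-- `Exists.choose` on `Finset.Nonempty` depends only on the finset. [folklore] -/
theorem kds_choose_congr {s t : Finset V} (hs : s.Nonempty) (ht : t.Nonempty) (e : s = t) :
    hs.choose = ht.choose := by
  subst e; rfl

section Orbit

variable [Fintype V] [DecidableEq V]

/-- Membership in the orbit finset `univ.filter (σ.SameCycle v ·)`. [folklore] -/
theorem kds_mem_orbit {σ : Perm V} {v w : V} :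
    w ∈ univ.filter (fun w => σ.SameCycle v w) ↔ σ.SameCycle v w := by
  simp

/-- Orbits are nonempty; `(kds_orbit_nonempty σ v).choose` is THE representative of the orbit of
`v` used throughout. [folklore] -/
theorem kds_orbit_nonempty (σ : Perm V) (v : V) :
    (univ.filter fun w => σ.SameCycle v w).Nonempty :=
  ⟨v, kds_mem_orbit.2 (SameCycle.refl σ v)⟩

/-- Points in the same cycle have the same orbit. [folklore] -/
theorem kds_orbit_eq_of_sameCycle {σ : Perm V} {v w : V} (h : σ.SameCycle v w) :
    univ.filter (fun x => σ.SameCycle v x) = univ.filter fun x => σ.SameCycle w x := by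
  ext x; simp only [kds_mem_orbit]; exact ⟨fun hx => h.symm.trans hx, fun hx => h.trans hx⟩

/-- The representative lies in the orbit. [folklore] -/
theorem kds_rep_sameCycle (σ : Perm V) (v : V) :
    σ.SameCycle v (kds_orbit_nonempty σ v).choose :=
  kds_mem_orbit.1 (kds_orbit_nonempty σ v).choose_spec

/-- Points in the same cycle have the same representative. [folklore] -/
theorem kds_rep_eq_of_sameCycle {σ : Perm V} {v w : V} (h : σ.SameCycle v w) :
    (kds_orbit_nonempty σ v).choose = (kds_orbit_nonempty σ w).choose :=
  kds_choose_congr _ _ (kds_orbit_eq_of_sameCycle h)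

/-- Permutations with the same orbits have the same representatives. [folklore] -/
theorem kds_rep_congr {σ τ : Perm V} (h : ∀ v w, σ.SameCycle v w ↔ τ.SameCycle v w) (v : V) :
    (kds_orbit_nonempty σ v).choose = (kds_orbit_nonempty τ v).choose :=
  kds_choose_congr _ _ (by ext w; simp [h])

end Orbit

/-! ## Alternating colourings -/

/-- An alternating colouring also alternates along `σ⁻¹`. [folklore] -/
theorem kds_alt_symm_apply {σ : Perm V} {col : V → Bool} (h : ∀ v, col (σ v) = !col v) (v : V) :
    col (σ.symm v) = !col v := by
  have := h (σ.symm v)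
  rw [apply_symm_apply] at this; rw [this, Bool.not_not]

/-- Along powers of `σ` an alternating colouring follows the parity of the exponent. [folklore] -/
theorem kds_alt_pow_apply {σ : Perm V} {col : V → Bool} (h : ∀ v, col (σ v) = !col v) (n : ℕ)
    (v : V) : col ((σ ^ n) v) = if Even n then col v else !col v := by
  induction n with
  | zero => simp
  | succ n ih =>
    rw [pow_succ', mul_apply, h, ih]
    by_cases hn : Even n <;> simp [hn, Nat.even_add_one]

section Colour

variable [Fintype V] [DecidableEq V]

/-- A permutation admitting an alternating colouring has all cycles of even length. [folklore] -/
theorem kds_alt_even_card_support {σ : Perm V} {col : V → Bool} (h : ∀ v, col (σ v) = !col v)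
    (c : Perm V) (hc : c ∈ σ.cycleFactorsFinset) : Even c.support.card := by
  obtain ⟨x, hx⟩ : c.support.Nonempty :=
    card_pos.1 (lt_of_lt_of_le two_pos (mem_cycleFactorsFinset_iff.1 hc).1.two_le_card_support)
  have hcx : c = σ.cycleOf x := cycle_is_cycleOf hx hc
  subst hcx
  have hfix := (σ.isCycleOn_support_cycleOf x).pow_card_apply hx
  have hcol := kds_alt_pow_apply h (σ.cycleOf x).support.card x
  rw [hfix] at hcol
  by_contra hne
  rw [if_neg hne] at hcol
  cases hb : col x <;> simp [hb] at hcol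

/-- **Uniqueness** of the normalised alternating colouring. [folklore] -/
theorem kds_col_unique {σ : Perm V} {col col' : V → Bool} (ha : ∀ v, col (σ v) = !col v)
    (hn : ∀ v, col (kds_orbit_nonempty σ v).choose = true) (ha' : ∀ v, col' (σ v) = !col' v)
    (hn' : ∀ v, col' (kds_orbit_nonempty σ v).choose = true) : col = col' := by
  funext v
  obtain ⟨n, hv⟩ := (kds_rep_sameCycle σ v).symm.exists_nat_pow_eq
  rw [← hv, kds_alt_pow_apply ha, kds_alt_pow_apply ha', hn, hn']

/-- **Existence** of the normalised alternating colouring for a fixed-point-free permutation all of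
whose cycles are even: colour `v` by the parity of its position from the representative of its
cycle. [folklore] -/
theorem kds_exists_col (σ : Perm V) (hfp : ∀ v, σ v ≠ v)
    (hev : ∀ c ∈ σ.cycleFactorsFinset, Even c.support.card) :
    ∃ col : V → Bool, (∀ v, col (σ v) = !col v) ∧
      ∀ v, col (kds_orbit_nonempty σ v).choose = true := by
  classical
  refine ⟨fun v => decide (∃ n : ℕ, Even n ∧ (σ ^ n) (kds_orbit_nonempty σ v).choose = v),
    fun v => ?_, fun v => ?_⟩
  · have hm : (kds_orbit_nonempty σ (σ v)).choose = (kds_orbit_nonempty σ v).choose :=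
      (kds_rep_eq_of_sameCycle (sameCycle_apply_right.2 (SameCycle.refl σ v))).symm
    dsimp only
    rw [hm]
    set m := (kds_orbit_nonempty σ v).choose with hmdef
    have hms : m ∈ σ.support := mem_support.2 (hfp m)
    have hℓ : Even (σ.cycleOf m).support.card := hev _ (cycleOf_mem_cycleFactorsFinset_iff.2 hms)
    have hcyc := σ.isCycleOn_support_cycleOf m
    have hmm : m ∈ (σ.cycleOf m).support := mem_support_cycleOf_iff.2 ⟨SameCycle.refl σ m, hms⟩
    obtain ⟨d, hd⟩ := hℓ
    by_cases h : ∃ n, Even n ∧ (σ ^ n) m = v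
    · obtain ⟨n, hn, hv⟩ := h
      rw [decide_eq_true (⟨n, hn, hv⟩ : ∃ n, Even n ∧ (σ ^ n) m = v), Bool.not_true,
        decide_eq_false_iff_not]
      rintro ⟨n', hn', hv'⟩
      have heq : (σ ^ n') m = (σ ^ (n + 1)) m := by rw [hv', pow_succ', mul_apply, hv]
      rw [hcyc.pow_apply_eq_pow_apply hmm] at heq
      have h2 : n' ≡ n + 1 [MOD 2] := Nat.ModEq.of_dvd ⟨d, by rw [hd]; ring⟩ heq
      obtain ⟨a, rfl⟩ := hn'
      obtain ⟨b, rfl⟩ := hn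
      simp only [Nat.ModEq] at h2
      omega
    · rw [decide_eq_false h, Bool.not_false, decide_eq_true_iff]
      obtain ⟨j, hj⟩ := (kds_rep_sameCycle σ v).symm.exists_nat_pow_eq
      have hjodd : ¬ Even j := fun hje => h ⟨j, hje, hj⟩
      exact ⟨j + 1, by rwa [Nat.even_add_one], by rw [pow_succ', mul_apply, hj]⟩
  · rw [decide_eq_true_iff]
    refine ⟨0, Even.zero, ?_⟩
    rw [← kds_rep_eq_of_sameCycle (kds_rep_sameCycle σ v), pow_zero, one_apply]

/-! ## The pair of fixed-point-free involutions of a coloured even cycle cover -/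

/-- Splitting `σ` along an alternating colouring gives two fixed-point-free involutions.
[folklore] -/
theorem kds_pair_mem {σ : Perm V} {col : V → Bool} (hfp : ∀ v, σ v ≠ v)
    (ha : ∀ v, col (σ v) = !col v) :
    ((fun v => if col v then σ v else σ.symm v, fun v => if col v then σ.symm v else σ v) :
        (V → V) × (V → V)) ∈
      (univ.filter fun f : V → V => ∀ v, f (f v) = v ∧ f v ≠ v) ×ˢ
        (univ.filter fun f : V → V => ∀ v, f (f v) = v ∧ f v ≠ v) := by
  have hfp' : ∀ v, σ.symm v ≠ v := fun v e =>
    hfp v ((Equiv.apply_eq_iff_eq_symm_apply σ).2 e.symm)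
  rw [mem_product, mem_filter, mem_filter]
  refine ⟨⟨mem_univ _, fun v => ?_⟩, ⟨mem_univ _, fun v => ?_⟩⟩ <;>
  · cases hc : col v <;> simp [hc, kds_alt_symm_apply ha, ha, hfp, hfp']

omit [Fintype V] [DecidableEq V] in
/-- The **parity lemma** for two fixed-point-free involutions `f₁, f₂` and `g = f₁ ∘ f₂`
(`f₂ ∘ gⁿ = g⁻ⁿ ∘ f₂`): `v` and `f₂ v` are never in the same `g`-orbit, and `f₂` maps `g`-orbits
to `g`-orbits. [folklore] -/
theorem kds_pair_orbits {f₁ f₂ : V → V} (h₁ : ∀ v, f₁ (f₁ v) = v ∧ f₁ v ≠ v)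
    (h₂ : ∀ v, f₂ (f₂ v) = v ∧ f₂ v ≠ v) (g : Perm V) (hg : ∀ v, g v = f₁ (f₂ v))
    (hg' : ∀ v, g.symm v = f₂ (f₁ v)) :
    (∀ v, ¬ g.SameCycle v (f₂ v)) ∧ ∀ a b, g.SameCycle a b → g.SameCycle (f₂ a) (f₂ b) := by
  set F₂ : Perm V := Function.Involutive.toPerm f₂ fun v => (h₂ v).1 with hF₂
  have hf₁g : ∀ v, f₁ v = g (f₂ v) := fun v => by rw [hg, (h₂ v).1]
  have hzz : ∀ (a b : ℤ) (x : V), (g ^ a) ((g ^ b) x) = (g ^ (a + b)) x := fun a b x => by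
    rw [zpow_add, mul_apply]
  have hg1 : ∀ x, g x = (g ^ (1 : ℤ)) x := fun x => by rw [zpow_one]
  have hsemi : SemiconjBy F₂ g g⁻¹ := by
    rw [SemiconjBy]
    ext v
    simp [hF₂, Perm.mul_apply, hg, hg']
  have hconj : ∀ (n : ℤ) (v : V), f₂ ((g ^ n) v) = (g ^ (-n)) (f₂ v) := by
    intro n v
    have := congrArg (fun τ : Perm V => τ v) (hsemi.zpow_right n).eq
    simpa [inv_zpow', Perm.mul_apply, hF₂] using this
  refine ⟨fun v => ?_, fun a b => ?_⟩
  · rintro ⟨i, hi⟩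
    obtain ⟨j, rfl | rfl⟩ := Int.even_or_odd' i
    · refine (h₂ ((g ^ j) v)).2 ?_
      rw [hconj, ← hi, hzz, show -j + 2 * j = j by ring]
    · refine (h₁ ((g ^ (j + 1)) v)).2 ?_
      rw [hf₁g, hconj, ← hi, hzz, hg1, hzz,
        show (1 : ℤ) + (-(j + 1) + (2 * j + 1)) = j + 1 by ring]
  · rintro ⟨n, hn⟩
    exact ⟨-n, by rw [← hconj, hn]⟩

omit [Fintype V] [DecidableEq V] in
/-- Registered form (sub-goal of `stub_kasteleynDetSq`) of the parity lemma `kds_pair_orbits`: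
for two fixed-point-free involutions `f₁, f₂` and `g = f₁ ∘ f₂`, no vertex `v` lies in the
`g`-orbit of `f₂ v`. [folklore] -/
theorem stub_kasteleynDetSq_pairOrbits :
    ∀ (V : Type) (f₁ f₂ : V → V), (∀ v, f₁ (f₁ v) = v ∧ f₁ v ≠ v) →
      (∀ v, f₂ (f₂ v) = v ∧ f₂ v ≠ v) → ∀ g : Equiv.Perm V, (∀ v, g v = f₁ (f₂ v)) →
      (∀ v, g.symm v = f₂ (f₁ v)) → ∀ v, ¬ g.SameCycle v (f₂ v) :=
  fun _ _ _ h₁ h₂ g hg hg' => (kds_pair_orbits h₁ h₂ g hg hg').1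

/-- **Every ordered pair of perfect matchings is an even cycle cover, split along a normalised
alternating colouring.** [folklore] -/
theorem kds_exists_preimage {f₁ f₂ : V → V} (h₁ : ∀ v, f₁ (f₁ v) = v ∧ f₁ v ≠ v)
    (h₂ : ∀ v, f₂ (f₂ v) = v ∧ f₂ v ≠ v) :
    ∃ (σ : Perm V) (col : V → Bool), (∀ v, σ v ≠ v) ∧ (∀ v, col (σ v) = !col v) ∧
      (∀ v, col (kds_orbit_nonempty σ v).choose = true) ∧
      (∀ v, (if col v then σ v else σ.symm v) = f₁ v) ∧
      ∀ v, (if col v then σ.symm v else σ v) = f₂ v := by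
  -- `g = f₁ ∘ f₂` and its orbits `O`, kept opaque
  obtain ⟨g, hg, hg'⟩ : ∃ g : Perm V, (∀ v, g v = f₁ (f₂ v)) ∧ ∀ v, g.symm v = f₂ (f₁ v) :=
    ⟨(Function.Involutive.toPerm f₁ fun v => (h₁ v).1) *
      (Function.Involutive.toPerm f₂ fun v => (h₂ v).1), fun v => rfl, fun v => rfl⟩
  obtain ⟨hpar, hmap⟩ := kds_pair_orbits h₁ h₂ g hg hg'
  have hf₁g : ∀ v, f₁ v = g (f₂ v) := fun v => by rw [hg, (h₂ v).1]
  obtain ⟨O, hO⟩ : ∃ O : V → Finset V, ∀ v, O v = univ.filter fun w => g.SameCycle v w :=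
    ⟨_, fun v => rfl⟩
  have hmO : ∀ v w, w ∈ O v ↔ g.SameCycle v w := fun v w => by rw [hO, kds_mem_orbit]
  have hOeq : ∀ v w, g.SameCycle v w → O v = O w := fun v w h => by
    rw [hO, hO, kds_orbit_eq_of_sameCycle h]
  -- components `C v = O v ∪ O (f₂ v)`, kept opaque
  obtain ⟨C, hC⟩ : ∃ C : V → Finset V, ∀ v, C v = O v ∪ O (f₂ v) := ⟨_, fun v => rfl⟩
  have hself : ∀ v, v ∈ C v := fun v => by
    rw [hC]; exact mem_union_left _ ((hmO v v).2 (SameCycle.refl g v))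
  have hCne : ∀ v, (C v).Nonempty := fun v => ⟨v, hself v⟩
  have hC2 : ∀ v, C (f₂ v) = C v := fun v => by rw [hC, hC, (h₂ v).1, union_comm]
  have hCg : ∀ v w, g.SameCycle v w → C w = C v := fun v w hvw => by
    rw [hC, hC, hOeq v w hvw, hOeq _ _ (hmap _ _ hvw)]
  have hCmem : ∀ v w, w ∈ C v → C w = C v := by
    intro v w hw
    rw [hC] at hw
    rcases mem_union.1 hw with hw | hw
    · exact hCg v w ((hmO _ _).1 hw)
    · rw [← hC2 v]; exact hCg _ _ ((hmO _ _).1 hw)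
  have hC1 : ∀ v, C (f₁ v) = C v := fun v => by
    rw [hf₁g]
    exact (hCg _ _ (sameCycle_apply_right.2 (SameCycle.refl _ _))).trans (hC2 v)
  have hpick : ∀ v w, C v = C w → (hCne v).choose = (hCne w).choose :=
    fun v w e => kds_choose_congr _ _ e
  -- the colouring, kept opaque
  obtain ⟨col, hcol⟩ : ∃ col : V → Bool, ∀ v, col v = decide ((hCne v).choose ∈ O v) :=
    ⟨_, fun v => rfl⟩
  have ha2 : ∀ v, col (f₂ v) = !col v := by
    intro v
    rw [hcol, hcol, hpick (f₂ v) v (hC2 v)]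
    have hp : (hCne v).choose ∈ O v ∪ O (f₂ v) := by rw [← hC]; exact (hCne v).choose_spec
    rcases mem_union.1 hp with hp1 | hp2
    · have : (hCne v).choose ∉ O (f₂ v) := fun hp2 =>
        hpar v (((hmO _ _).1 hp1).trans ((hmO _ _).1 hp2).symm)
      rw [decide_eq_false this, decide_eq_true hp1, Bool.not_true]
    · have : (hCne v).choose ∉ O v := fun hp1 =>
        hpar v (((hmO _ _).1 hp1).trans ((hmO _ _).1 hp2).symm)
      rw [decide_eq_true hp2, decide_eq_false this, Bool.not_false]
  have ha1 : ∀ v, col (f₁ v) = !col v := by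
    intro v
    rw [← ha2 v, hcol, hcol, hpick (f₁ v) (f₂ v) ((hC1 v).trans (hC2 v).symm), hf₁g,
      ← hOeq _ _ (sameCycle_apply_right.2 (SameCycle.refl g (f₂ v)))]
  -- the permutation, kept opaque
  obtain ⟨σ, hσ, hσ'⟩ : ∃ σ : Perm V, (∀ v, σ v = if col v then f₁ v else f₂ v) ∧
      ∀ v, σ.symm v = if col v then f₂ v else f₁ v := by
    refine ⟨⟨fun v => if col v then f₁ v else f₂ v, fun v => if col v then f₂ v else f₁ v,
      fun v => ?_, fun v => ?_⟩, fun v => rfl, fun v => rfl⟩ <;>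
    · cases hc : col v <;> simp [hc, ha1, ha2, (h₁ v).1, (h₂ v).1]
  have hfp : ∀ v, σ v ≠ v := by
    intro v
    rw [hσ]
    cases col v <;> simp [(h₁ v).2, (h₂ v).2]
  have hσa : ∀ v, col (σ v) = !col v := by
    intro v
    rw [hσ]
    cases hc : col v <;> simp [ha1, ha2, hc]
  -- `σ`-orbits are the components
  have hnear2 : ∀ v, σ.SameCycle v (f₂ v) := by
    intro v
    cases hc : col v
    · have e : σ v = f₂ v := by simp [hσ, hc]
      rw [← e]; exact sameCycle_apply_right.2 (SameCycle.refl _ _)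
    · have e : σ.symm v = f₂ v := by simp [hσ', hc]
      rw [← e]; exact sameCycle_symm_apply_right.2 (SameCycle.refl _ _)
  have hnear1 : ∀ v, σ.SameCycle v (f₁ v) := by
    intro v
    cases hc : col v
    · have e : σ.symm v = f₁ v := by simp [hσ', hc]
      rw [← e]; exact sameCycle_symm_apply_right.2 (SameCycle.refl _ _)
    · have e : σ v = f₁ v := by simp [hσ, hc]
      rw [← e]; exact sameCycle_apply_right.2 (SameCycle.refl _ _)
  have hnearg : ∀ v, σ.SameCycle v (g v) := fun v =>
    (hnear2 v).trans (by rw [hg]; exact hnear1 (f₂ v))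
  have horb1 : ∀ v w, g.SameCycle v w → σ.SameCycle v w := by
    intro v w hvw
    obtain ⟨n, rfl⟩ := hvw.exists_nat_pow_eq
    clear hvw
    induction n with
    | zero => rw [pow_zero, Perm.one_apply]
    | succ n ih => rw [pow_succ', mul_apply]; exact ih.trans (hnearg _)
  have horb : ∀ v w, σ.SameCycle v w ↔ w ∈ C v := by
    intro v w
    constructor
    · intro hvw
      obtain ⟨n, rfl⟩ := hvw.exists_nat_pow_eq
      clear hvw
      induction n with
      | zero => rw [pow_zero, Perm.one_apply]; exact hself v
      | succ n ih =>
        rw [pow_succ', mul_apply, hσ, ← hCmem _ _ ih]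
        split_ifs
        · rw [← hC1]; exact hself _
        · rw [← hC2]; exact hself _
    · intro hw
      rw [hC] at hw
      rcases mem_union.1 hw with hw | hw
      · exact horb1 _ _ ((hmO _ _).1 hw)
      · exact (hnear2 v).trans (horb1 _ _ ((hmO _ _).1 hw))
  -- normalisation
  have hn : ∀ v, col (kds_orbit_nonempty σ v).choose = true := by
    intro v
    have e : (univ.filter fun w => σ.SameCycle v w) = C v := by
      ext w; rw [kds_mem_orbit]; exact horb v w
    rw [kds_choose_congr (kds_orbit_nonempty σ v) (hCne v) e, hcol,
      hpick _ v (hCmem _ _ (hCne v).choose_spec), decide_eq_true_iff, hmO]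
  refine ⟨σ, col, hfp, hσa, hn, fun v => ?_, fun v => ?_⟩
  · rw [hσ, hσ']
    cases col v <;> simp
  · rw [hσ, hσ']
    cases col v <;> simp

end Colour

end Summit.ValiantsHypothesis.ValiantsHypothesis.Theorems.DivisionGapZeroOneTransfer
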